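import Literature.AlgebraicGeometry.Modules.IndexedFrames
import Literature.AlgebraicGeometry.Motives.GeneratingSectionsOfLineBundle
import HarnessLib

/-!
# Sections of a line bundle on an open piece, read on the ambient scheme in a global trivialisation

Topic `Literature/AlgebraicGeometry/Motives`; namespace `Literature.AlgebraicGeometry.Motives.GeneratingSections`.
THEOREMS ONLY (no definition, no named fact, no instance, no notation, no `sorry`).

The situation ([Hartshorne1977] II Lemma 5.14 / proof of Thm. 7.6, and the remark after [EGAII] Thm. 4.5.2 as it is
used in [MumfordFogartyKirwan1994] Ch. 3 §2 Thm. 3.8 and Ch. 7 §3 Thm. 7.9): a line bundle `𝓜` on a scheme `X` is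
trivialised on a family of opens `W b` — in the tree's currency an indexed rank-one frame system
`IF : IFrames 𝓜 W` (`Modules/IndexedFrames`: frames `𝒪 ≅ 𝓜|_{W b}`, transition UNITS `IF.tf b b'`) —, and on an OPEN
PIECE `G : Y ↪ X` (an open immersion) the restricted bundle `G^*𝓜 ≅ 𝓝` carries finitely many global sections
`t k ∈ Γ(Y, 𝓝)` (typically: `Y` is a model of the piece on which `𝓝` is very ample and the `t k` are the coordinates of
an embedding).  The gluing lemma ★ `Motives/GeneratingSectionsOfLocallyAmplePieces` («(G3)»,
`exists_generatingSections_of_affinePieces` / `isQuasiProjectiveOver_of_affinePieces`) wants these sections as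
COEFFICIENT FUNCTIONS ON `X`: for every index `b` a function `T k b ∈ Γ(X, W b ∩ G(Y))` — the coordinate of `t k`
in the `b`-th frame — with the transition rule `T k b' = g_{bb'} · T k b` for a cocycle of units `g`, together with
their non-vanishing loci `⋃_b X_{T k b}` (to be shown affine / covering).  This file provides exactly that:

* `IFrames.coord_eq_coord_mul_tfOn` — rank-one change of frame for a section over ANY open below two framed
  opens: `λ_a(s) = λ_b(s) · tf a b`;
* **`exists_coeff_along_openImmersion`** — for `G : Y ⟶ X` an open immersion with `G(Y) = U`, `IF : IFrames 𝓜 W`,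
  `φ : G^*𝓜 ≅ 𝓝` and sections `t : κ → Γ(𝓝, ⊤)`, there are `T k b ∈ Γ(X, W b ⊓ U)` with
  (i) the transition rule of (G3) for the unit cocycle `g b b' := IF.tfOn b' b (W b ⊓ W b') …`, and
  (ii) `⨆ b, X_{T k b} = G(⨆ y, Y_{c_k(y)})`, the image of the non-vanishing locus of `t k` computed in the
  point-indexed frame system `((IF.pullback G).mapIso φ).toFrameSystem hW` of `𝓝` — i.e. in the ★ `coeffAt` /
  `CocycleSections.ofFrameSystem` currency that ★ `Morphisms/ProjectiveOfPushforwardFrame` and every `toProj` lemma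
  of the tree emit.  So `haff` of (G3) is «image of an affine open under an open immersion» and `hcov` is the
  covering condition on `Y`.
* `isUnit_tfOn_swap` — the cocycle `g` consists of units (the `hg` input of (G3)).

Proof: `T k b` is the coordinate of `t k|` in the pulled-back-and-transported frame `(IF.pullback G).mapIso φ` on
`G⁻¹(W b)`, pushed to `X` along `Γ(Y, G⁻¹ W b) ≅ Γ(X, G(G⁻¹ W b))` (Mathlib `Scheme.Hom.appIso`) and restricted to
`W b ⊓ U = G(G⁻¹ W b)`; the transition rule is the rank-one change of frame on `Y`, whose transition functions are the
pulled-back ones (★ `IFrames.tf_pullback`, `tfOn_mapIso`); the loci are computed by Mathlib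
`Scheme.Hom.image_basicOpen` and the locus-compatibility of coefficients in two frames.

Cell `hodgecm-mathlib` (D-0151), F-9 (9d)/(M2) bridge, count-neutral: HC_CM is proved only modulo the 7 printed
citations until rung 0 closes; nothing here is about HC.

## References
* R. Hartshorne, *Algebraic Geometry*, GTM 52 (1977), II Lemma 5.14 (p. 118), II Thm. 7.1 and its proof (p. 150),
  II Ex. 5.16 (d). [Hartshorne1977]
* U. Görtz, T. Wedhorn, *Algebraic Geometry I*, 2nd ed. (2020), Prop. 11.15 and Remark 11.16 (p. 298), Prop. 13.47
  (pp. 392–393). [GortzWedhorn2020]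
* A. Grothendieck, J. Dieudonné, *EGA II* (1961), Thm. 4.5.2 and the remark following it. [EGAII]
-/

noncomputable section

-- `TopCat.Presheaf`/`Scheme.Modules` section bookkeeping across semireducible wrappers (as in Mathlib's
-- `AlgebraicGeometry/Modules` and the tree's `Motives/GeneratingSectionsOfIso`).
set_option backward.isDefEq.respectTransparency false

universe u v

open CategoryTheory Opposite TopologicalSpace AlgebraicGeometry
open Literature.AlgebraicGeometry.Modules

namespace Literature.AlgebraicGeometry.Modules.IFrames

variable {Y : Scheme.{u}} {ι : Type v} {M : Y.Modules} {W : ι → Y.Opens} (F : IFrames M W)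

/-- **Rank-one change of frame for a section over an open**: for two framed opens `W a`, `W b` of a module `M`
and a section `s` over `V ≤ W a ⊓ W b`, the coordinate of `s` in the frame `e_a` is the coordinate in `e_b` times the
transition function: `λ_a(s) = λ_b(s) · tf a b` (`e_b = tf a b · e_a`, [GortzWedhorn2020] (11.6) / Remark 11.16).
[cite: GortzWedhorn2020, Prop. 11.15 and Remark 11.16 (p. 298)] [cite: Hartshorne1977, II Ex. 5.16 (d)] -/
theorem coord_eq_coord_mul_tfOn (a b : ι) {V : Y.Opens} (ha : V ≤ W a) (hb : V ≤ W b) (s : Γ(M, V)) :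
    coord (F.frame a) (homOfLE ha) s PUnit.unit =
      coord (F.frame b) (homOfLE hb) s PUnit.unit * F.tfOn a b V ha hb := by
  classical
  -- `s = λ_b(s) • e_b|_V` and `e_b|_V = tf a b • e_a|_V`
  have hs := eq_coord_smul_of_subsingleton (F.frame b) (homOfLE hb) s PUnit.unit
  have hgen : M.presheaf.map (homOfLE hb).op (basisSection (F.frame b) PUnit.unit) =
      F.tfOn a b V ha hb • M.presheaf.map (homOfLE ha).op (basisSection (F.frame a) PUnit.unit) := by
    rw [map_basisSection_eq_sum_transition (F.frame a) (F.frame b) (homOfLE ha) (homOfLE hb),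
      Fintype.sum_subsingleton _ PUnit.unit, IFrames.tfOn,
      transitionDet_eq_of_subsingleton _ _ _ _ _ _ PUnit.unit PUnit.unit]
  rw [hgen, smul_smul] at hs
  have hc := congr_arg (fun r => coord (F.frame a) (homOfLE ha) r PUnit.unit) hs
  simp only at hc
  rw [coord_smul, coord_map_basisSection, if_pos rfl, mul_one] at hc
  exact hc

/-- The reversed transition function `tf b a`, read over `W a ⊓ W b`, is a unit (the `hg` input of ★
`exists_generatingSections_of_affinePieces`). [cite: GortzWedhorn2020, Prop. 11.15 and Remark 11.16 (p. 298)] -/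
theorem isUnit_tfOn_swap (a b : ι) : IsUnit (F.tfOn b a (W a ⊓ W b) inf_le_right inf_le_left) :=
  F.isUnit_tfOn b a _ _ _

end Literature.AlgebraicGeometry.Modules.IFrames

namespace Literature.AlgebraicGeometry.Motives

namespace GeneratingSections

variable {X Y : Scheme.{u}} (G : Y ⟶ X) {M : X.Modules} {β : Type v} {W : β → X.Opens}
  (IF : IFrames M W) {N : Y.Modules} (φ : (Scheme.Modules.pullback G).obj M ≅ N) {κ : Type} (t : κ → Γ(N, ⊤))
  (hW : ⨆ b, G ⁻¹ᵁ W b = ⊤)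

/-! ### The coefficients on the piece `Y` -/

/-- **Locus compatibility on the piece**: the non-vanishing locus of the coordinate of `t k` in the frame on
`G⁻¹ W b` is contained in the union, over the points `y`, of the loci of the coordinates in the frames CHOSEN at `y`
(the point-indexed frame system `toFrameSystem`) — both are the intrinsic locus `Y_{t k}` (Hartshorne II, proof of
Thm. 7.1: «`X_s` is well defined»). [cite: Hartshorne1977, II proof of Thm. 7.1 (p. 150)] -/
theorem basicOpen_coord_le_iSup_coeffAt (k : κ) (b : β) :
    Y.basicOpen (coord (((IF.pullback G).mapIso φ).frame b) (𝟙 (G ⁻¹ᵁ W b))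
        (N.presheaf.map (homOfLE le_top).op (t k)) PUnit.unit) ≤
      ⨆ y, Y.basicOpen (coeffAt (((IF.pullback G).mapIso φ).toFrameSystem hW) (fun _ => rfl) t k y) := by
  classical
  intro p hp
  set IFY := (IF.pullback G).mapIso φ with hIFY
  set FS := IFY.toFrameSystem hW with hFS
  -- the chosen index at `p` and the overlap `V`
  have hpb : p ∈ G ⁻¹ᵁ W b := Y.basicOpen_le _ hp
  have hpc : p ∈ FS.U p := FS.mem p
  let V : Y.Opens := (G ⁻¹ᵁ W b) ⊓ FS.U p
  have hVb : V ≤ G ⁻¹ᵁ W b := inf_le_left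
  have hVc : V ≤ FS.U p := inf_le_right
  -- change of frame on `V`: `λ_b = λ_{c p} · tf b (c p)`
  have key := IFY.coord_eq_coord_mul_tfOn b (IFrames.exists_index hW p).choose hVb hVc
    (N.presheaf.map (homOfLE (le_top : V ≤ ⊤)).op (t k))
  -- restrict the `b`-coordinate to `V`
  have e1 : Y.presheaf.map (homOfLE hVb).op (coord (IFY.frame b) (𝟙 (G ⁻¹ᵁ W b))
      (N.presheaf.map (homOfLE le_top).op (t k)) PUnit.unit) =
      coord (IFY.frame b) (homOfLE hVb) (N.presheaf.map (homOfLE (le_top : V ≤ ⊤)).op (t k)) PUnit.unit := by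
    rw [← coord_map (IFY.frame b) (𝟙 _) (homOfLE hVb), ← CategoryTheory.comp_apply, ← Functor.map_comp]
    rfl
  have e2 : Y.presheaf.map (homOfLE hVc).op (coeffAt FS (fun _ => rfl) t k p) =
      coord (IFY.frame (IFrames.exists_index hW p).choose) (homOfLE hVc)
        (N.presheaf.map (homOfLE (le_top : V ≤ ⊤)).op (t k)) PUnit.unit := by
    rw [map_coeffAt]
    rfl
  have hpV : p ∈ Y.basicOpen (Y.presheaf.map (homOfLE hVb).op (coord (IFY.frame b) (𝟙 (G ⁻¹ᵁ W b))
      (N.presheaf.map (homOfLE le_top).op (t k)) PUnit.unit)) := by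
    rw [Scheme.basicOpen_res]
    exact ⟨⟨hpb, hpc⟩, hp⟩
  rw [e1, key, Scheme.basicOpen_mul, Y.basicOpen_of_isUnit (IFY.isUnit_tfOn _ _ _ _ _), ← e2,
    Scheme.basicOpen_res] at hpV
  exact Opens.mem_iSup.mpr ⟨p, hpV.1.2⟩

/-- **The intrinsic locus of `t k` on the piece**, computed either in all the frames `G⁻¹ W b` or in the
point-indexed chosen frames, is the same open of `Y`. [cite: Hartshorne1977, II proof of Thm. 7.1 (p. 150)] -/
theorem iSup_basicOpen_coord_eq_iSup_coeffAt (k : κ) :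
    ⨆ b, Y.basicOpen (coord (((IF.pullback G).mapIso φ).frame b) (𝟙 (G ⁻¹ᵁ W b))
        (N.presheaf.map (homOfLE le_top).op (t k)) PUnit.unit) =
      ⨆ y, Y.basicOpen (coeffAt (((IF.pullback G).mapIso φ).toFrameSystem hW) (fun _ => rfl) t k y) := by
  apply le_antisymm
  · exact iSup_le fun b => basicOpen_coord_le_iSup_coeffAt G IF φ t hW k b
  · refine iSup_le fun y => ?_
    refine le_trans (le_of_eq ?_)
      (le_iSup (fun b => Y.basicOpen (coord (((IF.pullback G).mapIso φ).frame b) (𝟙 (G ⁻¹ᵁ W b))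
        (N.presheaf.map (homOfLE le_top).op (t k)) PUnit.unit)) (IFrames.exists_index hW y).choose)
    rw [coeffAt]
    rfl

/-! ### Pushing the coefficients to `X` -/

/-- Two restriction maps between the same opens agree. [folklore] -/
private theorem map_irrel {A B : X.Opens} (f g : op A ⟶ op B) (s : Γ(X, A)) :
    X.presheaf.map f s = X.presheaf.map g s := by
  rw [Quiver.Hom.unop_inj (Subsingleton.elim f.unop g.unop)]

/-- Two two-step restrictions between the same opens agree. [folklore] -/
private theorem map_map_irrel {A B B' C : X.Opens} (g : op A ⟶ op B) (f : op B ⟶ op C) (g' : op A ⟶ op B')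
    (f' : op B' ⟶ op C) (s : Γ(X, A)) :
    X.presheaf.map f (X.presheaf.map g s) = X.presheaf.map f' (X.presheaf.map g' s) := by
  simp only [← CategoryTheory.comp_apply, ← Functor.map_comp]
  exact map_irrel _ _ _

/-- `G(G⁻¹ W b) = W b ⊓ G(Y)`. [folklore] -/
private theorem image_preimage_eq [IsOpenImmersion G] (U : X.Opens) (hU : G.opensRange = U) (b : β) :
    W b ⊓ U = G ''ᵁ (G ⁻¹ᵁ W b) := by
  rw [Scheme.Hom.image_preimage_eq_opensRange_inf, hU, inf_comm]

/-- **THE BRIDGE.**  For an open immersion `G : Y ⟶ X` with image `U`, a line bundle `𝓜` on `X` framed on the opens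
`W b` (`IF : IFrames 𝓜 W`), an isomorphism `φ : G^*𝓜 ≅ 𝓝` and global sections `t k` of `𝓝` on the piece, there are
coefficient functions `T k b ∈ Γ(X, W b ⊓ U)` — «the coordinate of `t k` in the `b`-th frame» — such that
(i) `T k b' = g_{bb'} · T k b` on `(W b ⊓ U) ⊓ (W b' ⊓ U)` for the unit cocycle `g_{bb'} = tf b' b` (the `hT` input of
★ `exists_generatingSections_of_affinePieces`, token for token), and (ii) the non-vanishing locus `⋃_b X_{T k b}` is the
IMAGE under `G` of the locus of `t k` on `Y` computed in the point-indexed frame system of `𝓝` (★ `coeffAt`).  This is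
the bookkeeping behind «a section of `𝓝 ⊗ 𝓛^n` over `X_s` extends after raising `n`» ([Hartshorne1977] II 5.14) when
the piece `X_s` is presented by its own model `Y`. [cite: Hartshorne1977, II Lemma 5.14 (p. 118)]
[cite: GortzWedhorn2020, Prop. 11.15 and Remark 11.16 (p. 298)] -/
theorem exists_coeff_along_openImmersion [IsOpenImmersion G] (U : X.Opens) (hU : G.opensRange = U) :
    ∃ T : κ → ∀ b : β, Γ(X, W b ⊓ U),
      (∀ k b b', X.presheaf.map (homOfLE (inf_le_right : (W b ⊓ U) ⊓ (W b' ⊓ U) ≤ W b' ⊓ U)).op (T k b') =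
          X.presheaf.map (homOfLE (inf_le_inf inf_le_left inf_le_left :
              (W b ⊓ U) ⊓ (W b' ⊓ U) ≤ W b ⊓ W b')).op (IF.tfOn b' b (W b ⊓ W b') inf_le_right inf_le_left) *
            X.presheaf.map (homOfLE (inf_le_left : (W b ⊓ U) ⊓ (W b' ⊓ U) ≤ W b ⊓ U)).op (T k b)) ∧
      ∀ k, ⨆ b, X.basicOpen (T k b) =
        G ''ᵁ ⨆ y, Y.basicOpen (coeffAt (((IF.pullback G).mapIso φ).toFrameSystem hW) (fun _ => rfl) t k y) := by
  classical
  set IFY := (IF.pullback G).mapIso φ with hIFY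
  -- the coefficients on `Y`, pushed to `X`
  let cY : κ → ∀ b : β, Γ(Y, G ⁻¹ᵁ W b) := fun k b =>
    coord (IFY.frame b) (𝟙 (G ⁻¹ᵁ W b)) (N.presheaf.map (homOfLE le_top).op (t k)) PUnit.unit
  let T : κ → ∀ b : β, Γ(X, W b ⊓ U) := fun k b =>
    X.presheaf.map (homOfLE (image_preimage_eq G U hU b).le).op ((G.appIso (G ⁻¹ᵁ W b)).inv (cY k b))
  refine ⟨T, fun k b b' => ?_, fun k => ?_⟩
  · -- (i) the transition rule: everything is the image under `(G.appIso V').inv` of a `Y`-side identity on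
    -- `V' := G⁻¹ W b ⊓ G⁻¹ W b'`, restricted to `(W b ⊓ U) ⊓ (W b' ⊓ U)`
    let V' : Y.Opens := G ⁻¹ᵁ W b ⊓ G ⁻¹ᵁ W b'
    have hO : (W b ⊓ U) ⊓ (W b' ⊓ U) ≤ G ''ᵁ V' := by
      rintro x ⟨⟨hxb, hxU⟩, hxb', -⟩
      rw [← hU] at hxU
      obtain ⟨y, rfl⟩ := hxU
      exact ⟨y, ⟨hxb, hxb'⟩, rfl⟩
    -- restriction of `T k b`, `T k b'` to `G '' V'`
    have rT : ∀ (a : β) (ha : V' ≤ G ⁻¹ᵁ W a) (hle : (W b ⊓ U) ⊓ (W b' ⊓ U) ≤ W a ⊓ U),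
        X.presheaf.map (homOfLE hle).op (T k a) =
          X.presheaf.map (homOfLE hO).op ((G.appIso V').inv (Y.presheaf.map (homOfLE ha).op (cY k a))) := by
      intro a ha hle
      have nat := ConcreteCategory.congr_hom (G.appIso_inv_naturality (homOfLE ha).op) (cY k a)
      rw [CategoryTheory.comp_apply, CategoryTheory.comp_apply] at nat
      change X.presheaf.map (homOfLE hle).op (X.presheaf.map _ ((G.appIso (G ⁻¹ᵁ W a)).inv (cY k a))) = _
      rw [nat]
      exact map_map_irrel _ _ _ _ _
    -- restriction of `tfOn b' b` to `G '' V'`: it is the image of the pulled-back transition function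
    have rg : X.presheaf.map (homOfLE (inf_le_inf inf_le_left inf_le_left :
        (W b ⊓ U) ⊓ (W b' ⊓ U) ≤ W b ⊓ W b')).op (IF.tfOn b' b (W b ⊓ W b') inf_le_right inf_le_left) =
        X.presheaf.map (homOfLE hO).op ((G.appIso V').inv (IFY.tfOn b' b V' inf_le_right inf_le_left)) := by
      have h1 : IFY.tfOn b' b V' inf_le_right inf_le_left =
          G.appLE (W b ⊓ W b') V' (le_of_eq (G.preimage_inf (U := W b) (V := W b')).symm)
            (IF.tfOn b' b (W b ⊓ W b') inf_le_right inf_le_left) := by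
        rw [hIFY, IFrames.tfOn_mapIso]
        have hV' : V' ≤ G ⁻¹ᵁ W b' ⊓ G ⁻¹ᵁ W b := le_inf inf_le_right inf_le_left
        have h2 : (IF.pullback G).tfOn b' b V' inf_le_right inf_le_left =
            Y.presheaf.map (homOfLE hV').op (G.appLE (W b' ⊓ W b) (G ⁻¹ᵁ W b' ⊓ G ⁻¹ᵁ W b)
              (le_of_eq (G.preimage_inf (U := W b') (V := W b)).symm) (IF.tf b' b)) := by
          rw [← IF.tf_pullback G b' b]
          exact ((IF.pullback G).map_tf b' b hV').symm
        have h3 : IF.tfOn b' b (W b ⊓ W b') inf_le_right inf_le_left =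
            X.presheaf.map (homOfLE (le_inf inf_le_right inf_le_left : W b ⊓ W b' ≤ W b' ⊓ W b)).op
              (IF.tf b' b) :=
          (IF.map_tf b' b _).symm
        rw [h2, h3, ← CategoryTheory.comp_apply, Scheme.Hom.appLE_map, ← CategoryTheory.comp_apply,
          Scheme.Hom.map_appLE]
      rw [h1, ← CategoryTheory.comp_apply (G.appLE _ _ _), Scheme.Hom.appLE_appIso_inv,
        ← CategoryTheory.comp_apply, ← Functor.map_comp]
      rfl
    -- the `Y`-side identity
    have key := IFY.coord_eq_coord_mul_tfOn b' b (V := V') inf_le_right inf_le_left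
      (N.presheaf.map (homOfLE (le_top : V' ≤ ⊤)).op (t k))
    have eY : ∀ (a : β) (ha : V' ≤ G ⁻¹ᵁ W a), Y.presheaf.map (homOfLE ha).op (cY k a) =
        coord (IFY.frame a) (homOfLE ha) (N.presheaf.map (homOfLE (le_top : V' ≤ ⊤)).op (t k)) PUnit.unit := by
      intro a ha
      change Y.presheaf.map (homOfLE ha).op (coord (IFY.frame a) (𝟙 _) _ PUnit.unit) = _
      rw [← coord_map (IFY.frame a) (𝟙 _) (homOfLE ha), ← CategoryTheory.comp_apply, ← Functor.map_comp]
      rfl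
    rw [rT b' inf_le_right inf_le_right, rT b inf_le_left inf_le_left, rg, eY b' inf_le_right, eY b inf_le_left,
      key, map_mul, map_mul, mul_comm]
  · -- (ii) the loci
    have eb : ∀ b, X.basicOpen (T k b) = G ''ᵁ Y.basicOpen (cY k b) := by
      intro b
      change X.basicOpen (X.presheaf.map _ _) = _
      rw [Scheme.basicOpen_res, ← Scheme.image_basicOpen, inf_eq_right]
      exact (G.image_mono (Y.basicOpen_le _)).trans (image_preimage_eq G U hU b).ge
    simp_rw [eb]
    rw [← Scheme.Hom.image_iSup, iSup_basicOpen_coord_eq_iSup_coeffAt G IF φ t hW k]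

/-- **Corollary (the shape ★ (G3) consumes, with affineness and covering transported)**: if on the piece the loci
of the `t k` (in the point-indexed frame system of `𝓝`) are AFFINE and COVER `Y`, then the coefficient functions
`T k b` on `X` have affine non-vanishing loci `⋃_b X_{T k b} = G(Y_{t k})` whose union is `U = G(Y)`.
[cite: Hartshorne1977, II Lemma 5.14 (p. 118)] [cite: GortzWedhorn2020, Prop. 13.47 (pp. 392–393)] -/
theorem exists_coeff_along_openImmersion_of_isAffineOpen [IsOpenImmersion G] (U : X.Opens) (hU : G.opensRange = U)
    (haff : ∀ k, IsAffineOpen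
      (⨆ y, Y.basicOpen (coeffAt (((IF.pullback G).mapIso φ).toFrameSystem hW) (fun _ => rfl) t k y)))
    (hcov : ⨆ k, ⨆ y,
      Y.basicOpen (coeffAt (((IF.pullback G).mapIso φ).toFrameSystem hW) (fun _ => rfl) t k y) = ⊤) :
    ∃ T : κ → ∀ b : β, Γ(X, W b ⊓ U),
      (∀ k b b', X.presheaf.map (homOfLE (inf_le_right : (W b ⊓ U) ⊓ (W b' ⊓ U) ≤ W b' ⊓ U)).op (T k b') =
          X.presheaf.map (homOfLE (inf_le_inf inf_le_left inf_le_left :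
              (W b ⊓ U) ⊓ (W b' ⊓ U) ≤ W b ⊓ W b')).op (IF.tfOn b' b (W b ⊓ W b') inf_le_right inf_le_left) *
            X.presheaf.map (homOfLE (inf_le_left : (W b ⊓ U) ⊓ (W b' ⊓ U) ≤ W b ⊓ U)).op (T k b)) ∧
      (∀ k, IsAffineOpen (⨆ b, X.basicOpen (T k b))) ∧ ⨆ k, ⨆ b, X.basicOpen (T k b) = U := by
  obtain ⟨T, hT, hloc⟩ := exists_coeff_along_openImmersion G IF φ t hW U hU
  refine ⟨T, hT, fun k => ?_, ?_⟩
  · rw [hloc k]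
    exact (haff k).image_of_isOpenImmersion G
  · simp_rw [hloc]
    rw [← Scheme.Hom.image_iSup, hcov, ← hU]
    exact G.image_top_eq_opensRange

end GeneratingSections

end Literature.AlgebraicGeometry.Motives

end
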